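import Literature.NumberTheory.DiophantineGeometry.GenEllDeCoverFarFromCuspsMechanism

/-!
# [GenEll] Thm 2.1 for `ℙ¹` (route piece W7, family `t_c`): `hZfar ∧ hZmem` in the spine's currency
# for the bad polynomial `g := Res_r(curvePoly, G_m)` of ANY multiple `m` of `p·q·(p−q)`

Companion of `GenEllDeCoverFarFromCuspsMechanism` (stmt-ABC-19679; S. Mochizuki, *Arithmetic elliptic
curves in general position*, Math. J. Okayama Univ. **52** (2010), Thm. 2.1 (ii) ⇒ (i), proof p. 12
[cite: MochizukiGenEll2010, Thm 2.1 proof p.12]; abc-iut cell, `GenEllMechanismAssembly` of seat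
w5-d075 g2, 2026-08-26T02:58:05Z: the per-mechanism field is the compositum with the splitting field
of `m₀ := p·q·(p−q)·R_c`, and the bad set is cut out by ONE resultant).  There the resultant was taken
for `m := p·q·(p−q)` exactly; here `m` is any nonzero multiple of `p·q·(p−q)` (the extra factor only
enlarges the root set), so the assembly may use the resultant of its own `m₀` with no adapter:
* `De.fst_mem_aroots_resultant_of_fibre_of_dvd` — fibre `x`-coordinates are roots of
  `Res_r(curvePoly k, G_m)` in every algebraically closed `Ω ⊇ ℚ`;
* `exists_farFromCusps_dePoint_imageAt_resultant_of_dvd`,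
  `exists_farFromCusps_imageAt_of_far_aroots_resultant_of_dvd` — `hZfar ∧ hZmem` from the two
  `T`-membership binders at `∞` and at `2`, hypothesis-free, cover point `dePoint` resp. any
  presentation `Q`.
Theorems only; classical; nothing here bears on [IUTchIII] Cor. 3.12.
-/

namespace Literature.NumberTheory.DiophantineGeometry.GenEll

open Polynomial NumberField

/-! ### The junction for any fibre polynomial `m` divisible by `p·q·(p−q)` -/

section AnyMultiple

variable {Ω : Type*} [Field Ω] [CharZero Ω] [IsAlgClosed Ω]

/-- **Junction W7 ↔ spine, bad set cut out by ANY multiple `m` of `p·q·(p−q)`** (e.g.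
`m := p·q·(p−q)·R_c` with `R_c` the critical-value polynomial of `t_c`, the choice of the
`GenEllMechanismAssembly`): for `c ≠ 0` and `m ≠ 0` with `p·q·(p−q) ∣ m`, every non-pole point
`P' ∈ D_e(Ω)` with `p(t_c P') = 0 ∨ q(t_c P') = 0 ∨ (p − q)(t_c P') = 0` has
`P'.1 ∈ (Res_r(curvePoly k, G_m)).aroots Ω` — the containment hypotheses `hgℂ`, `hg₂` of
`exists_farFromCusps_imageAt_of_far_aroots` / `exists_farFromCusps_dePoint_imageAt` for
`g := resultant (De.curvePoly k) (De.homFibrePolyC k c m)`, at `Ω = ℂ` and `Ω = ℚ̄₂`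
(w5-d015's `De.rootSet_resultant_homFibrePolyC` with this `m`).
[cite: MochizukiGenEll2010, Thm 2.1 proof p.12] -/
theorem De.fst_mem_aroots_resultant_of_fibre_of_dvd (k : ℕ) {c : ℚ} (hc : c ≠ 0) {p q m : ℚ[X]}
    (hm : m ≠ 0) (hdvd : p * q * (p - q) ∣ m) (P' : Ω × Ω)
    (hcurve : P'.2 ^ (2 * k + 1) = P'.1 * (1 - P'.1)) (hr : P'.2 ≠ 0) (hs : 1 - 2 * P'.1 ≠ 0)
    (hfib : aeval (((1 - 2 * P'.1) + algebraMap ℚ Ω c * P'.2 ^ (k + 2)) / (P'.2 * (1 - 2 * P'.1))) p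
          = 0 ∨
        aeval (((1 - 2 * P'.1) + algebraMap ℚ Ω c * P'.2 ^ (k + 2)) / (P'.2 * (1 - 2 * P'.1))) q
          = 0 ∨
        aeval (((1 - 2 * P'.1) + algebraMap ℚ Ω c * P'.2 ^ (k + 2)) / (P'.2 * (1 - 2 * P'.1)))
          (p - q) = 0) :
    P'.1 ∈ (resultant (De.curvePoly k) (De.homFibrePolyC k c m)).aroots Ω := by
  classical
  have hmem : P'.1 ∈ (resultant (De.curvePoly k) (De.homFibrePolyC k c m)).rootSet Ω := by
    rw [De.rootSet_resultant_homFibrePolyC k hc hm]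
    refine ⟨P'.2, hcurve, hr, hs, ?_⟩
    obtain ⟨u, hu⟩ := hdvd
    rw [hu, map_mul, map_mul, map_mul]
    rcases hfib with h | h | h
    · rw [h, zero_mul, zero_mul, zero_mul]
    · rw [h, mul_zero, zero_mul, zero_mul]
    · rw [h, mul_zero, zero_mul]
  rw [Polynomial.mem_rootSet] at hmem
  exact Polynomial.mem_aroots.mpr hmem

/-- **W7 in the spine's currency, cover point `dePoint`, `g := Res_r(curvePoly k, G_m)` for any
multiple `m ≠ 0` of `p·q·(p−q)`** (no containment hypothesis).
[cite: MochizukiGenEll2010, Thm 2.1 proof p.12] -/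
theorem exists_farFromCusps_dePoint_imageAt_resultant_of_dvd (k : ℕ) {c : ℚ} (hc : c ≠ 0)
    {p q m : ℚ[X]} {n : ℕ} (hpn : p.natDegree = n) (hqn : q.natDegree = n)
    (hpqn : (p - q).natDegree = n) (hp0 : p ≠ 0) (hq0 : q ≠ 0) (hne : p ≠ q) (hm : m ≠ 0)
    (hdvd : p * q * (p - q) ∣ m) {ρ : ℝ} (hρ : 0 < ρ) (d : ℕ) :
    ∃ ρ' : ℝ, 0 < ρ' ∧ ρ' ≤ 1 / 2 ∧
      ∀ P : NFPoint,
        (∀ σ : P.F →+* ℂ,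
          ∀ a ∈ (resultant (De.curvePoly k) (De.homFibrePolyC k c m)).aroots ℂ, ρ < ‖σ P.x - a‖) →
        (∀ σ : P.F →+* PadicAlgCl 2,
          ∀ a ∈ (resultant (De.curvePoly k) (De.homFibrePolyC k c m)).aroots (PadicAlgCl 2),
            ρ < ‖σ P.x - a‖) →
        P ∈ UPle d → 1 - 2 * P.x ≠ 0 →
      NFPoint.FarFromCusps ({2} : Finset ℕ) ρ'
          ((P.dePoint (2 * k + 1)).imageAt
            (aeval (((1 - 2 * (P.dePoint (2 * k + 1)).x) +
                  algebraMap ℚ (P.deField (2 * k + 1)) c * P.deRoot (2 * k + 1) ^ (k + 2)) /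
                (P.deRoot (2 * k + 1) * (1 - 2 * (P.dePoint (2 * k + 1)).x))) p /
              aeval (((1 - 2 * (P.dePoint (2 * k + 1)).x) +
                  algebraMap ℚ (P.deField (2 * k + 1)) c * P.deRoot (2 * k + 1) ^ (k + 2)) /
                (P.deRoot (2 * k + 1) * (1 - 2 * (P.dePoint (2 * k + 1)).x))) q)) ∧
        (P.dePoint (2 * k + 1)).imageAt
            (aeval (((1 - 2 * (P.dePoint (2 * k + 1)).x) +
                  algebraMap ℚ (P.deField (2 * k + 1)) c * P.deRoot (2 * k + 1) ^ (k + 2)) /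
                (P.deRoot (2 * k + 1) * (1 - 2 * (P.dePoint (2 * k + 1)).x))) p /
              aeval (((1 - 2 * (P.dePoint (2 * k + 1)).x) +
                  algebraMap ℚ (P.deField (2 * k + 1)) c * P.deRoot (2 * k + 1) ^ (k + 2)) /
                (P.deRoot (2 * k + 1) * (1 - 2 * (P.dePoint (2 * k + 1)).x))) q) ∈
          UPle ((2 * k + 1) * d) :=
  exists_farFromCusps_dePoint_imageAt k hc hpn hqn hpqn hp0 hq0 hne hρ d _
    (fun P' hc' hr' hs' hfib =>
      De.fst_mem_aroots_resultant_of_fibre_of_dvd k hc hm hdvd P' hc' hr' hs' hfib)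
    (fun P' hc' hr' hs' hfib =>
      De.fst_mem_aroots_resultant_of_fibre_of_dvd k hc hm hdvd P' hc' hr' hs' hfib)

/-- **W7 in the spine's currency, any presentation `Q`, `g := Res_r(curvePoly k, G_m)` for any
multiple `m ≠ 0` of `p·q·(p−q)`** (no containment hypothesis; `Q` e.g. the compositum point
`⟨ℚ(x,r)(θ), x⟩` of the assembly, `ι` the composite embedding).
[cite: MochizukiGenEll2010, Thm 2.1 proof p.12] -/
theorem exists_farFromCusps_imageAt_of_far_aroots_resultant_of_dvd (k : ℕ) {c : ℚ} (hc : c ≠ 0)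
    {p q m : ℚ[X]} {n : ℕ} (hpn : p.natDegree = n) (hqn : q.natDegree = n)
    (hpqn : (p - q).natDegree = n) (hp0 : p ≠ 0) (hq0 : q ≠ 0) (hne : p ≠ q) (hm : m ≠ 0)
    (hdvd : p * q * (p - q) ∣ m) {ρ : ℝ} (hρ : 0 < ρ) (N : ℕ) :
    ∃ ρ' : ℝ, 0 < ρ' ∧ ρ' ≤ 1 / 2 ∧
      ∀ P : NFPoint,
        (∀ σ : P.F →+* ℂ,
          ∀ a ∈ (resultant (De.curvePoly k) (De.homFibrePolyC k c m)).aroots ℂ, ρ < ‖σ P.x - a‖) →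
        (∀ σ : P.F →+* PadicAlgCl 2,
          ∀ a ∈ (resultant (De.curvePoly k) (De.homFibrePolyC k c m)).aroots (PadicAlgCl 2),
            ρ < ‖σ P.x - a‖) →
      ∀ (Q : NFPoint) (ι : P.F →+* Q.F) (r : Q.F), Q.degree ≤ N →
        r ^ (2 * k + 1) = ι P.x * (1 - ι P.x) → r ≠ 0 → 1 - 2 * ι P.x ≠ 0 →
      NFPoint.FarFromCusps ({2} : Finset ℕ) ρ'
          (Q.imageAt
            (aeval (((1 - 2 * ι P.x) + algebraMap ℚ Q.F c * r ^ (k + 2)) / (r * (1 - 2 * ι P.x))) p /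
              aeval (((1 - 2 * ι P.x) + algebraMap ℚ Q.F c * r ^ (k + 2)) / (r * (1 - 2 * ι P.x)))
                q)) ∧
        Q.imageAt
            (aeval (((1 - 2 * ι P.x) + algebraMap ℚ Q.F c * r ^ (k + 2)) / (r * (1 - 2 * ι P.x))) p /
              aeval (((1 - 2 * ι P.x) + algebraMap ℚ Q.F c * r ^ (k + 2)) / (r * (1 - 2 * ι P.x)))
                q) ∈ UPle N :=
  exists_farFromCusps_imageAt_of_far_aroots k hc hpn hqn hpqn hp0 hq0 hne hρ N _
    (fun P' hc' hr' hs' hfib =>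
      De.fst_mem_aroots_resultant_of_fibre_of_dvd k hc hm hdvd P' hc' hr' hs' hfib)
    (fun P' hc' hr' hs' hfib =>
      De.fst_mem_aroots_resultant_of_fibre_of_dvd k hc hm hdvd P' hc' hr' hs' hfib)

end AnyMultiple

end Literature.NumberTheory.DiophantineGeometry.GenEll
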